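import Summits.QuantumFields.BalabanUV.Beta.CapRouteAWords
import Summits.QuantumFields.BalabanUV.Beta.CapRouteARealBall

/-!
# Beta / CapRouteAWordsRecords — ROUTE A FOR TRACE WORDS IN CERTIFICATE CURRENCY: the word-sum integrand over (box schedule, box records,
# fin schedules, table sups) with the (T) binder as the engines' PAIRED real ball
# (β sub-cell, BINDER-OWNERS row CAP-k, lineage `b2b-balaban-beta-an5`, gen 26; node BETA-an5-g26-SCHEDULES, leaf 8; journal l.17735 ∕ l.18638)

`CapRouteAWords` (leaf 7): the integrand `wordSum A T W = Σ_{(c,w) ∈ W} c · tr(X T_{w₁} X T_{w₂} ⋯)` (`X = A⁻¹`; the shape of the engines'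
jet functional at zero shift), its structure ∕ reality ∕ route-A bound, and the rows from vertex-tori data (`hBa`, `hdet` as hypotheses).
THIS LEAF discharges `hBa` and `hdet` from the SAME certificate inputs as the two-term anchors — nothing new is asked of the engines:

* §1 **`stripRegularC_wordSum_ofFinRects`** — STRUCTURE (`MatTubeHol A`, `MatTubeHol (T i)`), `MatNegTranspose A`, `MatConjSymm A`, ONE
  quarter-region box cover with per-leaf `IsUnit (A q).det ∧ ‖(A q)⁻¹‖ ≤ Ba`, `hR`, FOUR fin-rectangle covers with per-leaf `IsUnit (A p).det`,
  table sups `‖T i q‖ ≤ S i` on the vertex tori ⟹ `StripRegularC (wordSum A T W) κ (wordSumBound n Ba S W)`;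
  **`stripRegularC_wordSum_ofRecords`** — the same over (rational-root schedule `S`, `BlockLeafRecord`s, fin schedules `F`);
* §2 **`rowsOfWordSumCode16E_ofRecords`** — the word-sum anchor in certificate currency with the COMPLEX ball; `_k₀ = 0`;
* §3 **`rowsOfWordSumCode16E_ofRecords_ofPairedBall`** — the same with the (T) binder LITERALLY as two engines certify it (a real ball for
  `|S_E|⁻¹·(Σ_{S₀} Re g + 2·Σ_R Re g)` + decidable pairing data), the reality of `g` DISCHARGED from `MatConjSymm A`, `MatConjSymm (T i)` —
  NO `hsym` binder and NO zero-shift restriction (words carry no external momentum).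

THE BINDER LIST OF THE WORD-SUM TARGET (census v1.7.2 V34): (N) `hb : b 0 = Re ∫ wordSum` ∣ the word list `W` (DATA — the dictionary's
table-level object) ∣ STRUCTURE `MatTubeHol A`, `MatTubeHol (T i)`, `MatNegTranspose A`, `MatConjSymm A`, `MatConjSymm (T i)`, `hR` ∣ schedule
DATA + box records (decidable validity; per leaf FOUR SUPS + `hG`) ∣ fin schedules + per-leaf `IsUnit det` (or `FinLeafRecord`s via
`ResolventFinLeafRecord.hcertF_of_finRecords`) ∣ table sups `S i` ∣ (T) paired real ball ∣ (A) `hA₀` with `M := wordSumBound n Ba S W` ∣ cmp.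

HONEST FRAMING.  Kernel glue; no word list, schedule, record or number for the cell's `k₀` supplied; the constant is route A's
product-of-norms number (CAP-KERNEL §4.22: N-floor 8–9 for two-letter words, worse for four-letter words — this leaf does NOT improve the
price, it aligns the typed integrand's SHAPE with the engines' functional); 0 binders instantiated; 0 certified coefficients.  Discharging
`BetaPertH` would make Bałaban's ultraviolet stability unconditional — NOT the continuum limit, NOT the Clay problem.  0 `sorry`, 0 cite tags.
-/

namespace Summit.QuantumFields.BalabanUV.Beta.CapRouteAWordsRecords

open Complex Set Matrix
open Literature.MathematicalPhysics.QuantumFieldTheory.Balaban1983to89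
open B4Strip (Strip ofRealVec)
open B4ContourShift (latticeKernel StripRegular)
open B4TorusKernel (descend gridPt)
open Beta.AliasingTailL1 (aliasRatioL1 StripRegularC)
open Beta.AliasingTailLattice (codeTheta code16SetE)
open Summit.QuantumFields.BalabanUV.Beta.CapRows (Rows)
open Summit.QuantumFields.BalabanUV.Beta.TubeMaximumModulus
open Summit.QuantumFields.BalabanUV.Beta.VertexToriSymmetry
open Summit.QuantumFields.BalabanUV.Beta.ConjReflectionAlgebra (MatConjSymm)
open Summit.QuantumFields.BalabanUV.Beta.ResolventBoxCertificate (Box hBa_of_boxes_negConjRegion)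
open Summit.QuantumFields.BalabanUV.Beta.ResolventFinCertificate (of_fin_cover)
open Summit.QuantumFields.BalabanUV.Beta.TubeZeroFreeEnds
open Summit.QuantumFields.BalabanUV.Beta.TubeZeroFreeSymmetry
open Summit.QuantumFields.BalabanUV.Beta.CapRouteABoxesReflect (windingHyp_of_reflect_const)
open Summit.QuantumFields.BalabanUV.Beta.CapRowsLattice (rowsOfCode16E)
open Summit.QuantumFields.BalabanUV.Beta.CapRowsQhalf (rowsOfCode16E_ofRealBall sum_re_pairing)
open Summit.QuantumFields.BalabanUV.Beta.CoverSchedules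
open Summit.QuantumFields.BalabanUV.Beta.ResolventLeafRecord (BlockLeafRecord quarterBoxesQ hcov_of_schedulesQ hcert_of_records)
open Summit.QuantumFields.BalabanUV.Beta.CapRouteAWords
open scoped Real ComplexConjugate Matrix.Norms.L2Operator

noncomputable section

variable {n : Type*} [Fintype n] [DecidableEq n] {ι : Type*}

/-! ## §1 The word-sum binder from the certificate inputs -/

section Binder

variable {A : (Fin 4 → ℂ) → Matrix n n ℂ} {T : ι → (Fin 4 → ℂ) → Matrix n n ℂ} {κ Ba : ℝ} {S : ι → ℝ}

/-- **THE WORD-SUM BINDER FROM BOXES AND FINS**: STRUCTURE + `MatNegTranspose A` + `MatConjSymm A` + ONE quarter-region box cover with per-leaf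
`IsUnit (A q).det ∧ ‖(A q)⁻¹‖ ≤ Ba` + `hR` + FOUR fin-rectangle covers with per-leaf `IsUnit (A p).det` + table sups on the vertex tori ⟹
`StripRegularC (wordSum A T W) κ (wordSumBound n Ba S W)` — the same derivation as `CapRouteARealBall.stripRegularC_routeA_ofFinRects`, for words,
with NO shifted resolvent. [folklore] -/
theorem stripRegularC_wordSum_ofFinRects (hκ : 0 < κ) (hA : MatTubeHol A (fun _ => κ)) (hT : ∀ i, MatTubeHol (T i) (fun _ => κ))
    (hAn : MatNegTranspose A) (hAc : MatConjSymm A)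
    (ν₀ ν₁ : Fin (3 + 1)) {ιb : Type*} (boxes : Finset ιb) (ctr : ιb → Fin (3 + 1) → ℂ) (hw : ιb → Fin (3 + 1) → ℝ)
    (hcov : ∀ q ∈ VertexTori (fun _ : Fin (3 + 1) => κ), (q ν₀).im = κ → (q ν₁).re ≤ 0 → ∃ bx ∈ boxes, q ∈ Box (ctr bx) (hw bx))
    (hcert : ∀ bx ∈ boxes, ∀ q ∈ Box (ctr bx) (hw bx), IsUnit (A q).det ∧ ‖(A q)⁻¹‖ ≤ Ba)
    (hR : ∀ (ν : Fin (3 + 1)) (p : Fin (3 + 1) → ℂ), (A (reflectAt ν p)).det = (A p).det)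
    {ι' : Type*} (rects : Fin (3 + 1) → Finset ι') (τc xc hτ hx : Fin (3 + 1) → ι' → ℝ)
    (hcovF : ∀ (i : Fin (3 + 1)), ∀ τ ∈ Icc (0 : ℝ) 1, ∀ x ∈ Icc (-π) π,
      ∃ bx ∈ rects i, |τ - τc i bx| ≤ hτ i bx ∧ |x - xc i bx| ≤ hx i bx)
    (hcertF : ∀ (i : Fin (3 + 1)), ∀ bx ∈ rects i, ∀ τ x : ℝ, |τ - τc i bx| ≤ hτ i bx → |x - xc i bx| ≤ hx i bx →
      IsUnit (A (i.insertNth ((x : ℂ) + ((τ * κ : ℝ) : ℂ) * I) fun _ => ((τ * κ : ℝ) : ℂ) * I)).det)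
    (hS : ∀ i, ∀ q ∈ VertexTori (fun _ : Fin (3 + 1) => κ), ‖T i q‖ ≤ S i) (W : List (ℝ × List ι)) :
    StripRegularC (wordSum A T W) κ (wordSumBound n Ba S W) := by
  have hF : ∀ q ∈ VertexTori (fun _ : Fin (3 + 1) => κ), (A q).det ≠ 0 :=
    det_ne_zero_vertexTori_of_boxes_negConjRegion hAn hAc ν₀ ν₁ boxes ctr hw hcov hcert
  have hBa : ∀ p ∈ VertexTori (fun _ : Fin (3 + 1) => κ), ‖(A p)⁻¹‖ ≤ Ba :=
    hBa_of_boxes_negConjRegion hAn hAc ν₀ ν₁ boxes ctr hw hcov hcert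
  have hW4 : ∀ i : Fin (3 + 1), SliceWindingEq (fun p => (A p).det) (fun _ => κ) i fun _ => ((κ : ℝ) : ℂ) * I :=
    fun i => sliceWindingEq_allPlus_of_fin hA.det i (fun _ => hκ.le) (hR i) fun τ hτ' x hx' =>
      (of_fin_cover (rects i) (τc i) (xc i) (hτ i) (hx i) (hcovF i) (hcertF i) τ hτ' x hx').ne_zero
  have hW := windingHyp_of_reflect_const (G := fun p => (A p).det) hR hW4
  exact stripRegularC_wordSum_ofVertexTori hA hT (MatTubeHol.det_ne_zero_of_vertexTori hA hκ hF hW) hBa hS W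

variable {v u : Type*} [Fintype v] [Fintype u] [DecidableEq v] [DecidableEq u]

/-- **THE SAME OVER (RATIONAL-ROOT SCHEDULE, RECORDS, FIN SCHEDULES)**. [folklore] -/
theorem stripRegularC_wordSum_ofRecords (hκ : 0 < κ) (hA : MatTubeHol A (fun _ => κ)) (hT : ∀ i, MatTubeHol (T i) (fun _ => κ))
    (hAn : MatNegTranspose A) (hAc : MatConjSymm A)
    {R : ℚ} (hRπ : π ≤ (R : ℝ)) (ν₀ ν₁ : Fin (3 + 1)) (S' : (Fin (3 + 1) → Bool) → Sched 3)
    (rec : (Fin (3 + 1) → ℂ) × (Fin (3 + 1) → ℝ) → BlockLeafRecord 3)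
    (hvalid : ∀ bx ∈ quarterBoxesQ (fun _ : Fin (3 + 1) => κ) R ν₀ ν₁ S', (rec bx).Valid ∧ ((rec bx).B : ℝ) ≤ Ba)
    (hsub : ∀ bx ∈ quarterBoxesQ (fun _ : Fin (3 + 1) => κ) R ν₀ ν₁ S', Box bx.1 bx.2 ⊆ (rec bx).box)
    (e : v ⊕ u ≃ n) (G : (Fin (3 + 1) → ℂ) → Matrix v v ℂ) (X : (Fin (3 + 1) → ℂ) → Matrix v u ℂ)
    (Y : (Fin (3 + 1) → ℂ) → Matrix u v ℂ) (Z : (Fin (3 + 1) → ℂ) → Matrix u u ℂ)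
    (hG : ∀ bx ∈ quarterBoxesQ (fun _ : Fin (3 + 1) => κ) R ν₀ ν₁ S', ∀ q ∈ (rec bx).box,
      (A q).submatrix e e * fromBlocks (G q) (X q) (Y q) (Z q) = 1)
    (hsup : ∀ bx ∈ quarterBoxesQ (fun _ : Fin (3 + 1) => κ) R ν₀ ν₁ S',
      (∀ q ∈ (rec bx).box, ‖G q‖ ≤ (rec bx).a) ∧ (∀ q ∈ (rec bx).box, ‖X q‖ ≤ (rec bx).b) ∧
      (∀ q ∈ (rec bx).box, ‖Y q‖ ≤ (rec bx).c') ∧ (∀ q ∈ (rec bx).box, ‖Z q‖ ≤ (rec bx).e'))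
    (hRfl : ∀ (ν : Fin (3 + 1)) (p : Fin (3 + 1) → ℂ), (A (reflectAt ν p)).det = (A p).det)
    (F : Fin (3 + 1) → Sched 1)
    (hcertF : ∀ (i : Fin (3 + 1)), ∀ bx ∈ finRects (F i), ∀ τ x : ℝ, |τ - bx.1 0| ≤ bx.2 0 → |x - bx.1 1| ≤ bx.2 1 →
      IsUnit (A (i.insertNth ((x : ℂ) + ((τ * κ : ℝ) : ℂ) * I) fun _ => ((τ * κ : ℝ) : ℂ) * I)).det)
    (hS : ∀ i, ∀ q ∈ VertexTori (fun _ : Fin (3 + 1) => κ), ‖T i q‖ ≤ S i) (W : List (ℝ × List ι)) :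
    StripRegularC (wordSum A T W) κ (wordSumBound n Ba S W) :=
  stripRegularC_wordSum_ofFinRects hκ hA hT hAn hAc ν₀ ν₁ (quarterBoxesQ (fun _ : Fin (3 + 1) => κ) R ν₀ ν₁ S') Prod.fst Prod.snd
    (hcov_of_schedulesQ _ hRπ ν₀ ν₁ S') (hcert_of_records rec hvalid hsub e G X Y Z hG hsup) hRfl (fun i => finRects (F i))
    (fun _ bx => bx.1 0) (fun _ bx => bx.1 1) (fun _ bx => bx.2 0) (fun _ bx => bx.2 1) (hcovF_of_schedules F) hcertF hS W

end Binder

/-! ## §2 The word-sum anchor in certificate currency (complex ball) -/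

section Rows

variable {b : ℕ → ℝ} {A : (Fin 4 → ℂ) → Matrix n n ℂ} {T : ι → (Fin 4 → ℂ) → Matrix n n ℂ} {κ Ba : ℝ} {S : ι → ℝ}
variable {v u : Type*} [Fintype v] [Fintype u] [DecidableEq v] [DecidableEq u]

/-- **THE WORD-SUM ANCHOR OVER (SCHEDULE, RECORDS)**, complex ball. [folklore] -/
def rowsOfWordSumCode16E_ofRecords (W : List (ℝ × List ι)) (hb : b 0 = (latticeKernel (wordSum A T W) 0).re) (hκ : 0 < κ)
    (hA : MatTubeHol A (fun _ => κ)) (hT' : ∀ i, MatTubeHol (T i) (fun _ => κ)) (hAn : MatNegTranspose A) (hAc : MatConjSymm A)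
    {R : ℚ} (hRπ : π ≤ (R : ℝ)) (ν₀ ν₁ : Fin (3 + 1)) (S' : (Fin (3 + 1) → Bool) → Sched 3)
    (rec : (Fin (3 + 1) → ℂ) × (Fin (3 + 1) → ℝ) → BlockLeafRecord 3)
    (hvalid : ∀ bx ∈ quarterBoxesQ (fun _ : Fin (3 + 1) => κ) R ν₀ ν₁ S', (rec bx).Valid ∧ ((rec bx).B : ℝ) ≤ Ba)
    (hsub : ∀ bx ∈ quarterBoxesQ (fun _ : Fin (3 + 1) => κ) R ν₀ ν₁ S', Box bx.1 bx.2 ⊆ (rec bx).box)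
    (e : v ⊕ u ≃ n) (G : (Fin (3 + 1) → ℂ) → Matrix v v ℂ) (X : (Fin (3 + 1) → ℂ) → Matrix v u ℂ)
    (Y : (Fin (3 + 1) → ℂ) → Matrix u v ℂ) (Z : (Fin (3 + 1) → ℂ) → Matrix u u ℂ)
    (hG : ∀ bx ∈ quarterBoxesQ (fun _ : Fin (3 + 1) => κ) R ν₀ ν₁ S', ∀ q ∈ (rec bx).box,
      (A q).submatrix e e * fromBlocks (G q) (X q) (Y q) (Z q) = 1)
    (hsup : ∀ bx ∈ quarterBoxesQ (fun _ : Fin (3 + 1) => κ) R ν₀ ν₁ S',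
      (∀ q ∈ (rec bx).box, ‖G q‖ ≤ (rec bx).a) ∧ (∀ q ∈ (rec bx).box, ‖X q‖ ≤ (rec bx).b) ∧
      (∀ q ∈ (rec bx).box, ‖Y q‖ ≤ (rec bx).c') ∧ (∀ q ∈ (rec bx).box, ‖Z q‖ ≤ (rec bx).e'))
    (hRfl : ∀ (ν : Fin (3 + 1)) (p : Fin (3 + 1) → ℂ), (A (reflectAt ν p)).det = (A p).det)
    (F : Fin (3 + 1) → Sched 1)
    (hcertF : ∀ (i : Fin (3 + 1)), ∀ bx ∈ finRects (F i), ∀ τ x : ℝ, |τ - bx.1 0| ≤ bx.2 0 → |x - bx.1 1| ≤ bx.2 1 →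
      IsUnit (A (i.insertNth ((x : ℂ) + ((τ * κ : ℝ) : ℂ) * I) fun _ => ((τ * κ : ℝ) : ℂ) * I)).det)
    (hS : ∀ i, ∀ q ∈ VertexTori (fun _ : Fin (3 + 1) => κ), ‖T i q‖ ≤ S i)
    {N : ℕ} (hN : 1 ≤ N) [NeZero (4 * N)] {t r : ℝ}
    (hT : ‖((code16SetE N).card : ℂ)⁻¹ * (∑ w ∈ code16SetE N, descend (wordSum A T W) (gridPt (4 * N) w)) - t‖ ≤ r)
    {A₀ : ℝ} (hA₀ : wordSumBound n Ba S W * codeTheta (aliasRatioL1 κ N) ≤ A₀) (lo : ℚ) (hlo : ((lo : ℚ) : ℝ) ≤ t - r - A₀) :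
    Rows b :=
  rowsOfCode16E hb
    (stripRegularC_wordSum_ofRecords hκ hA hT' hAn hAc hRπ ν₀ ν₁ S' rec hvalid hsub e G X Y Z hG hsup hRfl F hcertF hS W)
    hκ hN hT hA₀ lo hlo

/-! ## §3 … and with the engines' PAIRED real ball, reality discharged -/

/-- **THE WORD-SUM ANCHOR OVER (SCHEDULE, RECORDS) WITH THE PAIRED BALL**: the (T) binder as two engines certify it — a real ball for
`|S_E|⁻¹·(Σ_{w ∈ S₀} Re g(w) + 2·Σ_{w ∈ R} Re g(w))` with decidable pairing data `S_E = S₀ ∪ R ∪ (−R)` — and NO reality binder: `g(−p) = conj g(p)`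
follows from `MatConjSymm A`, `MatConjSymm (T i)` (`conjSymm_wordSum`). [folklore] -/
def rowsOfWordSumCode16E_ofRecords_ofPairedBall (W : List (ℝ × List ι)) (hb : b 0 = (latticeKernel (wordSum A T W) 0).re)
    (hκ : 0 < κ) (hA : MatTubeHol A (fun _ => κ)) (hT' : ∀ i, MatTubeHol (T i) (fun _ => κ)) (hAn : MatNegTranspose A)
    (hAc : MatConjSymm A) (rT : ∀ i, MatConjSymm (T i))
    {R : ℚ} (hRπ : π ≤ (R : ℝ)) (ν₀ ν₁ : Fin (3 + 1)) (S' : (Fin (3 + 1) → Bool) → Sched 3)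
    (rec : (Fin (3 + 1) → ℂ) × (Fin (3 + 1) → ℝ) → BlockLeafRecord 3)
    (hvalid : ∀ bx ∈ quarterBoxesQ (fun _ : Fin (3 + 1) => κ) R ν₀ ν₁ S', (rec bx).Valid ∧ ((rec bx).B : ℝ) ≤ Ba)
    (hsub : ∀ bx ∈ quarterBoxesQ (fun _ : Fin (3 + 1) => κ) R ν₀ ν₁ S', Box bx.1 bx.2 ⊆ (rec bx).box)
    (e : v ⊕ u ≃ n) (G : (Fin (3 + 1) → ℂ) → Matrix v v ℂ) (X : (Fin (3 + 1) → ℂ) → Matrix v u ℂ)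
    (Y : (Fin (3 + 1) → ℂ) → Matrix u v ℂ) (Z : (Fin (3 + 1) → ℂ) → Matrix u u ℂ)
    (hG : ∀ bx ∈ quarterBoxesQ (fun _ : Fin (3 + 1) => κ) R ν₀ ν₁ S', ∀ q ∈ (rec bx).box,
      (A q).submatrix e e * fromBlocks (G q) (X q) (Y q) (Z q) = 1)
    (hsup : ∀ bx ∈ quarterBoxesQ (fun _ : Fin (3 + 1) => κ) R ν₀ ν₁ S',
      (∀ q ∈ (rec bx).box, ‖G q‖ ≤ (rec bx).a) ∧ (∀ q ∈ (rec bx).box, ‖X q‖ ≤ (rec bx).b) ∧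
      (∀ q ∈ (rec bx).box, ‖Y q‖ ≤ (rec bx).c') ∧ (∀ q ∈ (rec bx).box, ‖Z q‖ ≤ (rec bx).e'))
    (hRfl : ∀ (ν : Fin (3 + 1)) (p : Fin (3 + 1) → ℂ), (A (reflectAt ν p)).det = (A p).det)
    (F : Fin (3 + 1) → Sched 1)
    (hcertF : ∀ (i : Fin (3 + 1)), ∀ bx ∈ finRects (F i), ∀ τ x : ℝ, |τ - bx.1 0| ≤ bx.2 0 → |x - bx.1 1| ≤ bx.2 1 →
      IsUnit (A (i.insertNth ((x : ℂ) + ((τ * κ : ℝ) : ℂ) * I) fun _ => ((τ * κ : ℝ) : ℂ) * I)).det)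
    (hS : ∀ i, ∀ q ∈ VertexTori (fun _ : Fin (3 + 1) => κ), ‖T i q‖ ≤ S i)
    {N : ℕ} (hN : 1 ≤ N) [NeZero (4 * N)] (S₀ Rp : Finset (Fin (3 + 1) → Fin (4 * N)))
    (hdec : code16SetE N = S₀ ∪ Rp ∪ Rp.image (fun w => -w)) (hd₁ : Disjoint S₀ Rp)
    (hd₂ : Disjoint S₀ (Rp.image fun w => -w)) (hd₃ : Disjoint Rp (Rp.image fun w => -w)) {t r : ℝ}
    (hTpair : |((code16SetE N).card : ℝ)⁻¹ *
        (∑ w ∈ S₀, (descend (wordSum A T W) (gridPt (4 * N) w)).re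
          + 2 * ∑ w ∈ Rp, (descend (wordSum A T W) (gridPt (4 * N) w)).re) - t| ≤ r)
    {A₀ : ℝ} (hA₀ : wordSumBound n Ba S W * codeTheta (aliasRatioL1 κ N) ≤ A₀) (lo : ℚ) (hlo : ((lo : ℚ) : ℝ) ≤ t - r - A₀) :
    Rows b :=
  have hreg := stripRegularC_wordSum_ofRecords hκ hA hT' hAn hAc hRπ ν₀ ν₁ S' rec hvalid hsub e G X Y Z hG hsup hRfl F hcertF hS W
  have hsym := (conjSymm_wordSum (A := A) (T := T) hAc rT W).hsym
  rowsOfCode16E_ofRealBall hb hreg hκ hsym hN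
    (t := t) (r := r) (by
      rw [sum_re_pairing (hreg.toStripRegular hκ.le) hκ.le hsym S₀ Rp hdec hd₁ hd₂ hd₃]
      exact hTpair)
    hA₀ lo hlo

end Rows

end

end Summit.QuantumFields.BalabanUV.Beta.CapRouteAWordsRecords
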